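import Mathlib
import HarnessLib

/-!
# Route `RadicialJung`, crux `CleanModels` (stmt-ResolutionOfSingularities-15917), line `Sketch` rev 20, stub 4e
# `stub_cleanPrincipalization3`: toward L7b — THE CONTACT NORMAL FORM EXISTS (start of phase 1)

Memo `Cruxes/CleanModels/Lines/Sketch-memo-4e-cleanPermissible.md` rev 11.3 §2.3 `(μ,1)` (a), rev 10 §3: phase 1 of L7b starts from the
normal form `s = γ w^k + π` (`γ` a unit, `π ∈ 𝓘_{C,x}`, `(𝓘_{C,x}, w) = 𝔪_x`) of the local equation `s` of a clean component `H = V(s)` with respect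
to a regular curve `C` through `x` NOT contained in `H`; `k = v_C(s|_C)` is the contact order (`k = 0`: `H` misses `x` on `C`; `k = 1`:
transversal; `k ≥ 2`: tangency — the bad case).  This file proves its EXISTENCE by pure local algebra: for a Noetherian local ring `R`, an ideal
`P` and an element `w` with `P + (w) = 𝔪` (for the ideal of a regular curve through a point of a regular threefold such a `w` exists:
`exists_isRsopPart_append_span_eq`), every `s ∉ P` is `γ w^k + π` with `γ ∈ R^×`, `π ∈ P` (Krull's intersection theorem in `R/P`, whose maximal
ideal is generated by the image of `w`).  Consumers: `contact_drop_of_isBlowup_point` (✓ p690623) iterates the form along the point blow-ups,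
`isUnit_contact_drop_one` (✓ p690181) ends phase 1.
* `exists_contact_normalForm`.

Honest framing: OURS, elementary algebra; nothing here proves resolution in characteristic `p` or any case of `CleanModels`.
-/

set_option linter.dupNamespace false -- mandated namespace of this single-conjunct summit

open IsLocalRing

namespace Summit.ResolutionOfSingularities.ResolutionOfSingularities.Theorems.RadicialJung.CleanModels

/-- **Existence of the contact normal form.**  `R` Noetherian local, `P ⊆ R` an ideal and `w ∈ R` with `P + (w) = 𝔪_R`; then every `s ∉ P`
can be written `s = γ · w^k + π` with `γ` a unit and `π ∈ P` (and this `k` is the order of `s` in the discrete valuation ring `R/P` when `P` is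
the ideal of a regular curve).  Proof: the ideals `I_n := P + (w^n)` decrease to `P` (their images `(w̄^n) ⊆ 𝔪_{R/P}^n` meet in `0` by Krull's
intersection theorem), so there is a least `n₀ ≥ 1` with `s ∉ I_{n₀}`; writing `s = π + r w^{n₀−1}` from `s ∈ I_{n₀−1}`, the cofactor `r` is a unit,
for otherwise `r ∈ 𝔪 = P + (w)` would put `s` in `I_{n₀}`. [cite: Matsumura1987, Thm. 8.10 (Krull intersection theorem)] -/
theorem exists_contact_normalForm {R : Type*} [CommRing R] [IsLocalRing R] [IsNoetherianRing R] (P : Ideal R) (w : R)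
    (hw : P ⊔ Ideal.span {w} = maximalIdeal R) (s : R) (hs : s ∉ P) :
    ∃ (k : ℕ) (γ π : R), IsUnit γ ∧ π ∈ P ∧ s = γ * w ^ k + π := by
  classical
  -- `P ⊆ 𝔪` and `w ∈ 𝔪`
  have hPm : P ≤ maximalIdeal R := le_sup_left.trans hw.le
  have hwm : w ∈ maximalIdeal R := hw.le (Ideal.mem_sup_right (Ideal.mem_span_singleton_self w))
  -- the quotient `D = R/P` is local Noetherian and `R → D` is a local homomorphism
  have hPtop : P ≠ ⊤ := fun h => (maximalIdeal.isMaximal R).ne_top (top_le_iff.mp (h ▸ hPm))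
  haveI : Nontrivial (R ⧸ P) := Ideal.Quotient.nontrivial_iff.mpr hPtop
  haveI : IsLocalRing (R ⧸ P) := IsLocalRing.of_surjective' (Ideal.Quotient.mk P) Ideal.Quotient.mk_surjective
  haveI : IsLocalHom (Ideal.Quotient.mk P) :=
    isLocalHom_of_le_jacobson_bot P (by rw [IsLocalRing.jacobson_eq_maximalIdeal ⊥ bot_ne_top]; exact hPm)
  have hwD : Ideal.Quotient.mk P w ∈ maximalIdeal (R ⧸ P) := by
    rw [mem_maximalIdeal, mem_nonunits_iff]
    intro hu
    exact (mem_maximalIdeal _).mp hwm (hu.of_map)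
  -- not every `I_n = P + (w^n)` contains `s`
  have hex : ∃ n : ℕ, s ∉ P ⊔ Ideal.span {w ^ n} := by
    by_contra hall
    push Not at hall
    have hsD : Ideal.Quotient.mk P s ∈ ⨅ n : ℕ, (maximalIdeal (R ⧸ P)) ^ n := by
      refine Ideal.mem_iInf.mpr fun n => ?_
      have hmem := Ideal.mem_map_of_mem (Ideal.Quotient.mk P) (hall n)
      rw [Ideal.map_sup, Ideal.map_quotient_self, bot_sup_eq, Ideal.map_span, Set.image_singleton, map_pow] at hmem
      exact (Ideal.span_le.mpr (Set.singleton_subset_iff.mpr (Ideal.pow_mem_pow hwD n))) hmem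
    rw [Ideal.iInf_pow_eq_bot_of_isLocalRing _ (maximalIdeal.isMaximal (R ⧸ P)).ne_top] at hsD
    exact hs (Ideal.Quotient.eq_zero_iff_mem.mp hsD)
  -- the least such `n₀` is positive, and `k := n₀ - 1` works
  let n₀ := Nat.find hex
  have hn₀ : s ∉ P ⊔ Ideal.span {w ^ n₀} := Nat.find_spec hex
  have hn₀pos : 0 < n₀ := by
    by_contra h0
    have h00 : n₀ = 0 := by omega
    apply hn₀
    rw [h00, pow_zero, Ideal.span_singleton_one]
    exact le_sup_right (a := P) Submodule.mem_top
  obtain ⟨k, hk⟩ : ∃ k, n₀ = k + 1 := ⟨n₀ - 1, by omega⟩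
  have hsk : s ∈ P ⊔ Ideal.span {w ^ k} := by
    by_contra hnot
    have := Nat.find_min hex (show k < n₀ by omega)
    exact this hnot
  obtain ⟨π, hπ, q, hq, hπq⟩ := Submodule.mem_sup.mp hsk
  obtain ⟨r, rfl⟩ := Ideal.mem_span_singleton'.mp hq
  refine ⟨k, r, π, ?_, hπ, by rw [← hπq]; ring⟩
  -- `r` is a unit: otherwise `s ∈ I_{k+1}`
  by_contra hr
  have hrm : r ∈ maximalIdeal R := (mem_maximalIdeal _).mpr hr
  rw [← hw] at hrm
  obtain ⟨π', hπ', q', hq', hrq⟩ := Submodule.mem_sup.mp hrm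
  obtain ⟨r', rfl⟩ := Ideal.mem_span_singleton'.mp hq'
  apply hn₀
  rw [hk, ← hπq, ← hrq]
  -- rewrite `(π' + r' w) w^k = π' w^k + r' w^(k+1)`
  have : π + (π' + r' * w) * w ^ k = (π + π' * w ^ k) + r' * w ^ (k + 1) := by ring
  rw [this]
  exact Submodule.add_mem_sup (P.add_mem hπ (P.mul_mem_right _ hπ')) (Ideal.mem_span_singleton'.mpr ⟨r', rfl⟩)

end Summit.ResolutionOfSingularities.ResolutionOfSingularities.Theorems.RadicialJung.CleanModels
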